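/-
Copyright (c) 2026. All rights reserved.
Released under Apache 2.0 license as described in the file LICENSE.
Authors: abc-iut cell, wave-4 seat abc-iut-w4-d059 (proof-only; the TWO-SIDED vertex / edge dictionaries
(I1)–(I3) for the deck action on a coset-graph tower, in abc-iut-L3-d4's `SubgroupPresentation` currency).
-/
import Literature.AnabelianGeometry.SemiGraphs.SubgroupPresentationCosetGraph
import Literature.AnabelianGeometry.SemiGraphs.SubdivisionPaths
import HarnessLib

/-!
# [SemiAnbd] Thm 3.7 (iii) p. 41 / §5 p. 65: stabilisers of compatible vertex and edge systems of a
# coset-graph tower under the deck action (proof-only)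

Mochizuki, *Semi-graphs of anabelioids*, Publ. RIMS **42** (2006), proof of Thm 3.7 (iii) p. 41 with the
author's Comments (6) (the verticial / edge-like subgroups are read off compatible systems of vertices /
edges of the graphs `𝔾_j` of a cofinal tower) and §5 p. 65 (the same for `Π^temp_𝔊`).
[cite: MochizukiSemiAnbd2006, Thm 3.7(iii) p.41]

PROOF-ONLY file (abc-iut cell, sub-DAG `plan/L3/SUBDAG-SemiAnbd-Thm54.md`, producer row T54-B, sub-row
«T54-B-dict2», seat abc-iut-w4-d059) over abc-iut-L3-d4's `SubgroupPresentationCosetGraph.lean` (T1a): for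
a presentation `P` (vertex groups `H_w`, edge groups `M_e`, branch elements `s_b`) of a graph of groups in
`Γ` and an antitone family of normal subgroups `K_j` (the tree levels), the tower of coset graphs
`P.cosetGraph (K j)` with its transition maps and DECK ACTIONS satisfies the TWO-SIDED dictionaries that
abc-iut-w4-d059's (AI1)–(AI3) files take as input for the restricted action of `Π^temp_𝔾`:

* one level: `deckAct_fixes_vMk_iff` / `deckAct_fixes_eMk_iff` — `g` fixes the class `H_w y K` iff
  `y g y⁻¹ ∈ H_w · K` (edges: `M_e`); `deckAct_fixes_branches_of_fixes_eMk` — a fixed edge class has fixed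
  branches (no branch switching in coset graphs);
* the tower, under the two ALGEBRAIC hypotheses `hHK : ⋂_j H_w · K_j = H_w` (resp. `hMK` for `M_e`; in the
  tempered situation: `H_w` compact, `K_j` open, `⋂ K_j = 1` — abc-iut-L3-t11's
  `iInter_mul_coe_eq_of_isCompact`) and `hlift` (every compatible system of double cosets `H_w y_j K_j`
  comes from ONE `y`; in the tempered situation: completeness of `Π^temp_𝔾` for the tree levels plus
  Kőnig on the finite images of the compact `H_w`):
  (I2) two-sided `exists_rep_and_stabilizer_of_compatible` — a compatible vertex system is `(H_w y K_j)_j`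
  for one `y`, and its full stabiliser is `y⁻¹ H_w y`; (I1) two-sided `stabilizer_vMk_system`; (I3)
  two-sided `stabilizer_eMk_system` (with branches) and the end-point data `ends_eMk_system` of the edge
  system `(M_e y K_j)_j` (branch classes of the two branches, end classes `H_{w_i} s_{b_i} y K_j`, distinct
  when the coset graphs are trees).

No definition; nothing here takes a side on [IUTchIII] Cor. 3.12; typed ≠ proved elsewhere.
-/

namespace Literature.AnabelianGeometry.SemiGraphs

namespace SemiGraph

namespace SubgroupPresentation

open CategoryTheory
open scoped Pointwise

universe v u

variable {𝔾 : SemiGraph.{u}} {Γ : Type u} [Group Γ] (P : SubgroupPresentation 𝔾 Γ)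

/-! ### One level: fixed classes under the deck action -/

section OneLevel

variable (K : Subgroup Γ)

/-- Vertices of the coset graph over the same base vertex are equal iff their classes are.
[cite: MochizukiSemiAnbd2006, Thm 3.7(iii) p.41] -/
theorem vMk_eq_vMk_iff {w : 𝔾.Vertex} {y y' : Γ} :
    P.vMk K w y = P.vMk K w y' ↔ DoubleCoset.mk (P.H w) K y = DoubleCoset.mk (P.H w) K y' :=
  ⟨fun h => eq_of_heq (Sigma.mk.inj_iff.mp h).2, fun h => congrArg (Sigma.mk w) h⟩

/-- Edges of the coset graph over the same base edge are equal iff their classes are.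
[cite: MochizukiSemiAnbd2006, Thm 3.7(iii) p.41] -/
theorem eMk_eq_eMk_iff {e : 𝔾.Edge} {y y' : Γ} :
    P.eMk K e y = P.eMk K e y' ↔ DoubleCoset.mk (P.M e) K y = DoubleCoset.mk (P.M e) K y' :=
  ⟨fun h => eq_of_heq (Sigma.mk.inj_iff.mp h).2, fun h => congrArg (Sigma.mk e) h⟩

/-- The class `L y K` is fixed by right translation by `g⁻¹` iff `y g y⁻¹ ∈ L · K` (any subgroup `L`,
`K` normal). [cite: MochizukiSemiAnbd2006, Thm 3.7(iii) p.41] -/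
theorem mk_mul_inv_eq_iff [K.Normal] (L : Subgroup Γ) (g y : Γ) :
    DoubleCoset.mk L K (y * g⁻¹) = DoubleCoset.mk L K y ↔ y * g * y⁻¹ ∈ (L : Set Γ) * (K : Set Γ) := by
  rw [DoubleCoset.eq, Set.mem_mul]
  constructor
  · rintro ⟨h, hh, k, hk, hy⟩
    refine ⟨h, hh, (y * g⁻¹) * k * (y * g⁻¹)⁻¹, Subgroup.Normal.conj_mem ‹K.Normal› k hk _, ?_⟩
    calc h * (y * g⁻¹ * k * (y * g⁻¹)⁻¹) = (h * (y * g⁻¹) * k) * (y * g⁻¹)⁻¹ := by group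
      _ = y * (y * g⁻¹)⁻¹ := by rw [← hy]
      _ = y * g * y⁻¹ := by group
  · rintro ⟨h, hh, k', hk', hprod⟩
    refine ⟨h, hh, (g * y⁻¹) * k' * (g * y⁻¹)⁻¹, Subgroup.Normal.conj_mem ‹K.Normal› k' hk' _, ?_⟩
    calc y = (y * g * y⁻¹) * (y * g⁻¹) := by group
      _ = h * k' * (y * g⁻¹) := by rw [hprod]
      _ = h * (y * g⁻¹) * (g * y⁻¹ * k' * (g * y⁻¹)⁻¹) := by group

/-- **`g` fixes the vertex class `H_w y K` under the deck action iff `y g y⁻¹ ∈ H_w · K`.**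
[cite: MochizukiSemiAnbd2006, Thm 3.7(iii) p.41] -/
theorem deckAct_fixes_vMk_iff [K.Normal] (g : Γ) (w : 𝔾.Vertex) (y : Γ) :
    (P.deckAct K g).hom.vertexMap (P.vMk K w y) = P.vMk K w y ↔
      y * g * y⁻¹ ∈ (P.H w : Set Γ) * (K : Set Γ) := by
  rw [P.deckAct_vertexMap_vMk, vMk_eq_vMk_iff, mk_mul_inv_eq_iff]

/-- **`g` fixes the edge class `M_e y K` under the deck action iff `y g y⁻¹ ∈ M_e · K`.**
[cite: MochizukiSemiAnbd2006, Thm 3.7(iii) p.41] -/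
theorem deckAct_fixes_eMk_iff [K.Normal] (g : Γ) (e : 𝔾.Edge) (y : Γ) :
    (P.deckAct K g).hom.edgeMap (P.eMk K e y) = P.eMk K e y ↔
      y * g * y⁻¹ ∈ (P.M e : Set Γ) * (K : Set Γ) := by
  rw [P.deckAct_edgeMap_eMk, eMk_eq_eMk_iff, mk_mul_inv_eq_iff]

/-- **No branch switching in coset graphs**: an element fixing the edge class `M_e y K` fixes each of its
branches (a branch of the coset graph is a branch of `𝔾` together with an edge class).
[cite: MochizukiSemiAnbd2006, Thm 3.7(iii) p.41] -/
theorem deckAct_fixes_branches_of_fixes_eMk [K.Normal] (g : Γ) (e : 𝔾.Edge) (y : Γ)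
    (h : (P.deckAct K g).hom.edgeMap (P.eMk K e y) = P.eMk K e y)
    (br : (P.cosetGraph K).Branch) (hbr : (P.cosetGraph K).edgeOf br = P.eMk K e y) :
    (P.deckAct K g).hom.branchMap br = br := by
  obtain ⟨b, y', rfl⟩ := P.bMk_surjective K br
  -- `edgeOf (bMk b y') = eMk (edgeOf b) y'`, so `e = edgeOf b` and the classes agree
  have he : 𝔾.edgeOf b = e := congrArg Sigma.fst hbr
  subst he
  have hcl : DoubleCoset.mk (P.M (𝔾.edgeOf b)) K y' = DoubleCoset.mk (P.M (𝔾.edgeOf b)) K y :=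
    (P.eMk_eq_eMk_iff K).mp hbr
  have hcl' : DoubleCoset.mk (P.M (𝔾.edgeOf b)) K (y' * g⁻¹) = DoubleCoset.mk (P.M (𝔾.edgeOf b)) K y' := by
    have h1 : DoubleCoset.mk (P.M (𝔾.edgeOf b)) K (y * g⁻¹) = DoubleCoset.mk (P.M (𝔾.edgeOf b)) K y :=
      (P.eMk_eq_eMk_iff K).mp (by rw [← P.deckAct_edgeMap_eMk]; exact h)
    -- right translation by `g⁻¹` respects classes
    have h2 : DoubleCoset.mk (P.M (𝔾.edgeOf b)) K (y' * g⁻¹) = DoubleCoset.mk (P.M (𝔾.edgeOf b)) K (y * g⁻¹) :=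
      (P.eMk_eq_eMk_iff K).mp (by
        rw [← P.deckAct_edgeMap_eMk, ← P.deckAct_edgeMap_eMk]
        exact congrArg _ ((P.eMk_eq_eMk_iff K).mpr hcl))
    rw [h2, h1, hcl]
  rw [P.deckAct_branchMap_bMk]
  exact Subtype.ext (Prod.ext rfl (congrArg (Sigma.mk (𝔾.edgeOf b)) hcl'))

/-- Membership in `H.map (conj z⁻¹) = z⁻¹ H z`. [folklore] -/
private theorem mem_map_conj_inv_iff (H : Subgroup Γ) (z g : Γ) :
    g ∈ H.map (MulAut.conj z⁻¹).toMonoidHom ↔ z * g * z⁻¹ ∈ H := by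
  constructor
  · rintro ⟨h, hh, rfl⟩
    simpa [MulAut.conj_apply, mul_assoc] using hh
  · intro hg
    exact ⟨z * g * z⁻¹, hg, by simp [mul_assoc]⟩

end OneLevel

/-! ### The tower: transition maps on representatives -/

section Tower

variable {J : Type v} [Preorder J] (K : J → Subgroup Γ) [∀ j, (K j).Normal]
  (hK : ∀ ⦃i j : J⦄, i ≤ j → K j ≤ K i)

omit [∀ j, (K j).Normal] in
/-- The transition maps on vertex representatives: `H_w y K_j ↦ H_w y K_i`.
[cite: MochizukiSemiAnbd2006, Thm 3.7(iii) p.41] -/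
@[simp] theorem cosetGraphTrans_vertexMap_vMk ⦃i j : J⦄ (h : i ≤ j) (w : 𝔾.Vertex) (y : Γ) :
    (P.cosetGraphTrans (hK h)).vertexMap (P.vMk (K j) w y) = P.vMk (K i) w y := rfl

omit [∀ j, (K j).Normal] in
/-- The transition maps on edge representatives. [cite: MochizukiSemiAnbd2006, Thm 3.7(iii) p.41] -/
@[simp] theorem cosetGraphTrans_edgeMap_eMk ⦃i j : J⦄ (h : i ≤ j) (e : 𝔾.Edge) (y : Γ) :
    (P.cosetGraphTrans (hK h)).edgeMap (P.eMk (K j) e y) = P.eMk (K i) e y := rfl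

omit [∀ j, (K j).Normal] in
/-- The transition maps on branch representatives. [cite: MochizukiSemiAnbd2006, Thm 3.7(iii) p.41] -/
@[simp] theorem cosetGraphTrans_branchMap_bMk ⦃i j : J⦄ (h : i ≤ j) (b : 𝔾.Branch) (y : Γ) :
    (P.cosetGraphTrans (hK h)).branchMap (P.bMk (K j) b y) = P.bMk (K i) b y := rfl

/-! ### (I1)/(I2) two-sided: vertex systems and their stabilisers -/

/-- **(I1) two-sided**: the vertex system `(H_w y K_j)_j` is compatible, and — when `⋂_j H_w · K_j = H_w`
(`hHK`; tempered case: `H_w` compact, `K_j` open with trivial intersection) — its full stabiliser under the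
deck actions is EXACTLY `y⁻¹ H_w y`. [cite: MochizukiSemiAnbd2006, Thm 3.7(iii) p.41] -/
theorem stabilizer_vMk_system [IsDirectedOrder J] [Nonempty J]
    (hHK : ∀ (w : 𝔾.Vertex) (x : Γ), (∀ j, x ∈ (P.H w : Set Γ) * (K j : Set Γ)) → x ∈ P.H w)
    (w : 𝔾.Vertex) (y : Γ) :
    (∀ ⦃i j : J⦄ (h : i ≤ j), (P.cosetGraphTrans (hK h)).vertexMap (P.vMk (K j) w y) = P.vMk (K i) w y) ∧
      ∀ g : Γ, (∀ j, (P.deckAct (K j) g).hom.vertexMap (P.vMk (K j) w y) = P.vMk (K j) w y) ↔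
        g ∈ (P.H w).map (MulAut.conj y⁻¹).toMonoidHom := by
  refine ⟨fun i j h => rfl, fun g => ?_⟩
  simp only [deckAct_fixes_vMk_iff, mem_map_conj_inv_iff]
  exact ⟨fun h => hHK w _ h, fun h j => Set.mem_mul.mpr ⟨_, h, 1, (K j).one_mem, mul_one _⟩⟩

/-- **(I2) two-sided**: a compatible system of vertices of the coset-graph tower is `(H_w y K_j)_j` for ONE
representative `y` — when every compatible system of double cosets lifts (`hlift`; tempered case:
completeness of `Π^temp_𝔾` for the tree levels and Kőnig on the finite images of the compact `H_w`) — and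
then its full stabiliser under the deck actions is EXACTLY the conjugate `y⁻¹ H_w y`.
[cite: MochizukiSemiAnbd2006, Thm 3.7(iii) p.41] -/
theorem exists_rep_and_stabilizer_of_compatible [IsDirectedOrder J] [Nonempty J]
    (hHK : ∀ (w : 𝔾.Vertex) (x : Γ), (∀ j, x ∈ (P.H w : Set Γ) * (K j : Set Γ)) → x ∈ P.H w)
    (hlift : ∀ (w : 𝔾.Vertex) (y : J → Γ),
      (∀ ⦃i j : J⦄, i ≤ j → DoubleCoset.mk (P.H w) (K i) (y j) = DoubleCoset.mk (P.H w) (K i) (y i)) →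
      ∃ z : Γ, ∀ j, DoubleCoset.mk (P.H w) (K j) z = DoubleCoset.mk (P.H w) (K j) (y j))
    (x : ∀ j, (P.cosetGraph (K j)).Vertex)
    (hx : ∀ ⦃i j : J⦄ (h : i ≤ j), (P.cosetGraphTrans (hK h)).vertexMap (x j) = x i) :
    ∃ (w : 𝔾.Vertex) (y : Γ), (∀ j, x j = P.vMk (K j) w y) ∧
      ∀ g : Γ, (∀ j, (P.deckAct (K j) g).hom.vertexMap (x j) = x j) ↔
        g ∈ (P.H w).map (MulAut.conj y⁻¹).toMonoidHom := by
  choose w y hxy using fun j => P.vMk_surjective (K j) (x j)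
  obtain ⟨j₀⟩ := ‹Nonempty J›
  -- the base vertex is constant along the (directed) system
  have hfst : ∀ ⦃i j : J⦄, i ≤ j → w j = w i := by
    intro i j h
    have := hx h
    rw [hxy j, hxy i, cosetGraphTrans_vertexMap_vMk] at this
    exact congrArg Sigma.fst this
  have hw : ∀ j, w j = w j₀ := by
    intro j
    obtain ⟨k, hjk, hj₀k⟩ := exists_ge_ge j j₀
    rw [← hfst hjk, ← hfst hj₀k]
  have hxy' : ∀ j, x j = P.vMk (K j) (w j₀) (y j) := fun j => by rw [hxy j, hw j]
  -- the classes are compatible, hence lift to one representative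
  have hcl : ∀ ⦃i j : J⦄, i ≤ j →
      DoubleCoset.mk (P.H (w j₀)) (K i) (y j) = DoubleCoset.mk (P.H (w j₀)) (K i) (y i) := by
    intro i j h
    have := hx h
    rw [hxy' j, hxy' i, cosetGraphTrans_vertexMap_vMk] at this
    exact (P.vMk_eq_vMk_iff (K i)).mp this
  obtain ⟨z, hz⟩ := hlift (w j₀) y hcl
  have hxz : ∀ j, x j = P.vMk (K j) (w j₀) z := fun j => by
    rw [hxy' j]; exact (P.vMk_eq_vMk_iff (K j)).mpr (hz j).symm
  refine ⟨w j₀, z, hxz, fun g => ?_⟩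
  simp only [hxz]
  exact (P.stabilizer_vMk_system K hK hHK (w j₀) z).2 g

/-! ### (I3) two-sided: edge systems, their branches, stabilisers and end-points -/

/-- **(I3) two-sided, for the edge system `(M_e y K_j)_{j ≥ j₁}`**: it is compatible, an element fixing an
edge class fixes its branches, and — when `⋂_j M_e · K_j = M_e` (`hMK`) — the full stabiliser of the
system (edges with their branches) is EXACTLY `y⁻¹ M_e y`. [cite: MochizukiSemiAnbd2006, Thm 3.7(iii) p.41] -/
theorem stabilizer_eMk_system [IsDirectedOrder J]
    (hMK : ∀ (e : 𝔾.Edge) (x : Γ), (∀ j, x ∈ (P.M e : Set Γ) * (K j : Set Γ)) → x ∈ P.M e)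
    (e : 𝔾.Edge) (y : Γ) (j₁ : J) :
    (∀ ⦃i j : {j : J // j₁ ≤ j}⦄ (h : i.1 ≤ j.1),
        (P.cosetGraphTrans (hK h)).edgeMap (P.eMk (K j.1) e y) = P.eMk (K i.1) e y) ∧
      ∀ g : Γ, (∀ j : {j : J // j₁ ≤ j}, (P.deckAct (K j.1) g).hom.edgeMap (P.eMk (K j.1) e y) = P.eMk (K j.1) e y ∧
          ∀ br : (P.cosetGraph (K j.1)).Branch, (P.cosetGraph (K j.1)).edgeOf br = P.eMk (K j.1) e y →
            (P.deckAct (K j.1) g).hom.branchMap br = br) ↔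
        g ∈ (P.M e).map (MulAut.conj y⁻¹).toMonoidHom := by
  refine ⟨fun i j h => rfl, fun g => ?_⟩
  rw [mem_map_conj_inv_iff]
  constructor
  · intro h
    apply hMK e
    intro i
    obtain ⟨j, hij, hj₁⟩ := exists_ge_ge i j₁
    have := (P.deckAct_fixes_eMk_iff (K j) g e y).mp (h ⟨j, hj₁⟩).1
    obtain ⟨m, hm, k, hk, hmk⟩ := Set.mem_mul.mp this
    exact Set.mem_mul.mpr ⟨m, hm, k, hK hij hk, hmk⟩
  · intro h j
    have hfix : (P.deckAct (K j.1) g).hom.edgeMap (P.eMk (K j.1) e y) = P.eMk (K j.1) e y :=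
      (P.deckAct_fixes_eMk_iff (K j.1) g e y).mpr (Set.mem_mul.mpr ⟨_, h, 1, (K j.1).one_mem, mul_one _⟩)
    exact ⟨hfix, P.deckAct_fixes_branches_of_fixes_eMk (K j.1) g e y hfix⟩

omit [∀ j, (K j).Normal] in
/-- **A compatible eventual system of edges of the coset-graph tower is `(M_e y K_j)_{j ≥ j₁}` for ONE
representative `y`** (given the lifting property `hliftE` for compatible edge classes).
[cite: MochizukiSemiAnbd2006, Thm 3.7(iii) p.41] -/
theorem exists_rep_of_compatible_edges [IsDirectedOrder J]
    (j₁ : J)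
    (hliftE : ∀ (e : 𝔾.Edge) (y : {j : J // j₁ ≤ j} → Γ),
      (∀ ⦃i j : {j : J // j₁ ≤ j}⦄, i.1 ≤ j.1 →
        DoubleCoset.mk (P.M e) (K i.1) (y j) = DoubleCoset.mk (P.M e) (K i.1) (y i)) →
      ∃ z : Γ, ∀ j, DoubleCoset.mk (P.M e) (K j.1) z = DoubleCoset.mk (P.M e) (K j.1) (y j))
    (ε : ∀ j : {j : J // j₁ ≤ j}, (P.cosetGraph (K j.1)).Edge)
    (hε : ∀ ⦃i j : {j : J // j₁ ≤ j}⦄ (h : i.1 ≤ j.1), (P.cosetGraphTrans (hK h)).edgeMap (ε j) = ε i) :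
    ∃ (e : 𝔾.Edge) (y : Γ), ∀ j, ε j = P.eMk (K j.1) e y := by
  haveI : IsDirectedOrder {j : J // j₁ ≤ j} := by
    refine ⟨fun a b => ?_⟩
    obtain ⟨c, hac, hbc⟩ := exists_ge_ge a.1 b.1
    exact ⟨⟨c, a.2.trans hac⟩, hac, hbc⟩
  choose e y hεy using fun j : {j : J // j₁ ≤ j} => P.eMk_surjective (K j.1) (ε j)
  set j₀ : {j : J // j₁ ≤ j} := ⟨j₁, le_rfl⟩
  have hfst : ∀ ⦃i j : {j : J // j₁ ≤ j}⦄, i.1 ≤ j.1 → e j = e i := by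
    intro i j h
    have := hε h
    rw [hεy j, hεy i, cosetGraphTrans_edgeMap_eMk] at this
    exact congrArg Sigma.fst this
  have he : ∀ j, e j = e j₀ := by
    intro j
    obtain ⟨k, hjk, hj₀k⟩ := exists_ge_ge j j₀
    rw [← hfst (i := j) (j := k) hjk, ← hfst (i := j₀) (j := k) hj₀k]
  have hεy' : ∀ j, ε j = P.eMk (K j.1) (e j₀) (y j) := fun j => by rw [hεy j, he j]
  have hcl : ∀ ⦃i j : {j : J // j₁ ≤ j}⦄, i.1 ≤ j.1 →
      DoubleCoset.mk (P.M (e j₀)) (K i.1) (y j) = DoubleCoset.mk (P.M (e j₀)) (K i.1) (y i) := by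
    intro i j h
    have := hε h
    rw [hεy' j, hεy' i, cosetGraphTrans_edgeMap_eMk] at this
    exact (P.eMk_eq_eMk_iff (K i.1)).mp this
  obtain ⟨z, hz⟩ := hliftE (e j₀) y hcl
  exact ⟨e j₀, z, fun j => by rw [hεy' j]; exact (P.eMk_eq_eMk_iff (K j.1)).mpr (hz j).symm⟩

omit [∀ j, (K j).Normal] in
/-- **The end-point data of the edge system `(M_e y K_j)_j`**: for the two branches `b₁ ≠ b₂` of `e`,
abutting to `w₁`, `w₂`, the branch systems `(b_i, M_e y K_j)` and the compatible vertex systems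
`(H_{w_i} s_{b_i} y K_j)_j`, which are the abutment vertices, and which are DISTINCT at every level whose
coset graph is a tree (two branches of one edge of a tree abut to distinct vertices).
[cite: MochizukiSemiAnbd2006, Thm 3.7(iii) p.41] -/
theorem ends_eMk_system (e : 𝔾.Edge) (y : Γ) {b₁ b₂ : 𝔾.Branch} (hb : b₁ ≠ b₂)
    (hb₁ : 𝔾.edgeOf b₁ = e) (hb₂ : 𝔾.edgeOf b₂ = e) {w₁ w₂ : 𝔾.Vertex}
    (hw₁ : 𝔾.abuts b₁ = some w₁) (hw₂ : 𝔾.abuts b₂ = some w₂)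
    (hT : ∀ j, (P.cosetGraph (K j)).IsTree) :
    (∀ ⦃i j : J⦄ (h : i ≤ j),
        (P.cosetGraphTrans (hK h)).vertexMap (P.vMk (K j) w₁ (P.s b₁ * y)) = P.vMk (K i) w₁ (P.s b₁ * y)) ∧
      (∀ ⦃i j : J⦄ (h : i ≤ j),
        (P.cosetGraphTrans (hK h)).vertexMap (P.vMk (K j) w₂ (P.s b₂ * y)) = P.vMk (K i) w₂ (P.s b₂ * y)) ∧
      ∀ j, P.vMk (K j) w₁ (P.s b₁ * y) ≠ P.vMk (K j) w₂ (P.s b₂ * y) ∧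
        (P.cosetGraph (K j)).edgeOf (P.bMk (K j) b₁ y) = P.eMk (K j) e y ∧
        (P.cosetGraph (K j)).edgeOf (P.bMk (K j) b₂ y) = P.eMk (K j) e y ∧
        (P.cosetGraph (K j)).abuts (P.bMk (K j) b₁ y) = some (P.vMk (K j) w₁ (P.s b₁ * y)) ∧
        (P.cosetGraph (K j)).abuts (P.bMk (K j) b₂ y) = some (P.vMk (K j) w₂ (P.s b₂ * y)) := by
  subst hb₁
  have he₁ : ∀ j, (P.cosetGraph (K j)).edgeOf (P.bMk (K j) b₁ y) = P.eMk (K j) (𝔾.edgeOf b₁) y :=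
    fun j => rfl
  have he₂ : ∀ j, (P.cosetGraph (K j)).edgeOf (P.bMk (K j) b₂ y) = P.eMk (K j) (𝔾.edgeOf b₁) y :=
    fun j => by rw [← hb₂]; rfl
  refine ⟨fun i j h => rfl, fun i j h => rfl, fun j => ⟨fun hx => hb ?_, he₁ j, he₂ j,
    P.cosetGraph_abuts_bMk (K j) b₁ w₁ hw₁ y, P.cosetGraph_abuts_bMk (K j) b₂ w₂ hw₂ y⟩⟩
  -- two branches of one edge of a tree abutting to the same vertex are equal
  have h12 : P.bMk (K j) b₁ y = P.bMk (K j) b₂ y :=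
    SemiGraph.branch_unique_of_isAcyclic (hT j).isTree.isAcyclic ((he₁ j).trans (he₂ j).symm)
      (P.cosetGraph_abuts_bMk (K j) b₁ w₁ hw₁ y) (by rw [hx]; exact P.cosetGraph_abuts_bMk (K j) b₂ w₂ hw₂ y)
  exact congrArg (fun br : (P.cosetGraph (K j)).Branch => br.1.1) h12

end Tower

end SubgroupPresentation

end SemiGraph

end Literature.AnabelianGeometry.SemiGraphs
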